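import Literature.MathematicalPhysics.QuantumFieldTheory.Balaban1983to89.B9LettersZQstarFieldsAtPinsL2R
import Literature.MathematicalPhysics.QuantumFieldTheory.Balaban1983to89.B9BackgroundsKLevelV1R
import Literature.MathematicalPhysics.QuantumFieldTheory.Balaban1983to89.Node00.OpsYRecordV4P
import Literature.MathematicalPhysics.QuantumFieldTheory.Balaban1983to89.B9RWSums347DefiniteFaces
import Literature.MathematicalPhysics.QuantumFieldTheory.Balaban1983to89.B9Thm312WholeDir

/-!
# BalabanUVNodes ∕ N06 ([B9], `Dag.B9_main`) — CASCADE-K PIECE K2 (director-ym №383): THE BLOCK-L² `G₀Q\*` FAMILY AND THE `Q` LINE OF `…N06G0QstarL2LettersLegAtPinsPU`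
# RE-PRESSED WITH THE AVERAGING PAIR's BLOCK-L² MAJORANTS DISPLAYED AS LAWS (the straight-pair pins `hQsco12`, `hQco12` REMOVED)

Track A of `YM-PLAN.md` (cell `pub-ymgap`, HUMAN RULING D-0062), node **N06** = [Balaban1985BackgroundPropagators] Thms 3.1–3.15; bundle F7 rows 20–21, seat
`pub-ymgap-dag-n06-l` (g36).  A HELPER for dag-n06-d's knit certificate skeleton «K» (K3).
WHY.  `g0qstar_l2_letters_of_pins` (✓, this lineage g30) composes the G₀ layer's block-L² lines (`Thm33G0L2M`) with the block-L² letters of `Q\*` and `Q` read off the PINS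
`hQsco12 ∕ hQco12` at def-Y's straight-contour pair (`QscoKH ∕ QcoKH … parBY …`, dag-n06-w5's `blockBd_QscoKH_len` ∕ `blockBd_Q_pinsB_len`, which carry [4] (2.60)'s transfer
threshold `log L ≤ (2L²−1)M`).  At the knit certificate the pair is print's `(qKnitOfRecord, qsKnitOfRecord)` (dag-n06-d ⚑ LOCATED-K).  This file is the parametric re-press:
the pin package `bI hβ1 hblk12 hblkZ12 hQsco12 hQco12 hGR` is REPLACED by TWO displayed block-L² laws in the engines' own currency — `hqsL2K : … Reg335 → BlockBd blkZ blk (Q⋆ U)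
(BQ·(Lʲη(y))⁻¹·(v_Z·Lʲη)(y′)·e^{−δQ d})` and `hqL2K : … Reg335 → BlockBd blk blkZ (Q U) (BQ·(v_Z·Lʲη)(y)·(Lʲη(y′))⁻¹·e^{−δQ d})`, `BQ ≥ 0`, `δQ ≥ δ12₃ + 1` (`v_Z = √(vol⁻¹)`) —
and the engines are this lineage's generic block-L² compositions `B9Thm313WholeQstarFromG0.gQs_l2_of_l0 ∕ dGQs_l2_of_l1 ∕ ddGQs_l2_of_l3` called VERBATIM (the transfer
threshold disappears with the pins: it lives inside the straight-pair instance of the laws).  Instances: the straight pair (laws by `blockBd_QscoKH_len` ∕ `blockBd_Q_pinsB_len`,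
`BQ = L·e^{(δQ+1)(ℓ+4)}` above the (2.60) threshold) recovers the landed theorem; the knit pair's laws = the block-L² sizes of print's `Q ∕ Q†` (dag-n06-c's (L7) line, (3.15)).
★★★ `g0qstar_l2_letters_of_laws`.  HONEST FRAMING.  Mechanical re-press; the G₀-layer lines and the two block-L² majorants are HYPOTHESES; COUNT-NEUTRAL; nothing of [B9]'s
propagator estimates asserted; N06 NOT discharged; K1 NOT closed; one finite 𝕋⁴ programme at fixed `ε` — NOT continuum, NOT OS, NOT the mass gap ∕ Clay.  0 `def`, 0 `sorry`.
[cite: Balaban1985BackgroundPropagators, Thm 3.13 p.426, (3.153) p.426, (3.46) p.398, p.398 (remark after (3.47)), (3.110) p.417, (3.13) p.393, (3.15) p.393, (3.115) p.418;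
Balaban1984PropagatorsII, (2.26) p.228, Lemma 2.1 (2.60)–(2.61) p.234; Balaban1984PropagatorsI, (1.18) p.20]
-/

noncomputable section

namespace Summit.QuantumFields.YangMills.BalabanUVNodes.N06G0QstarL2LettersLegAtPinsPUPar

open scoped Matrix.Norms.L2Operator
open Literature.MathematicalPhysics.QuantumFieldTheory.Balaban1983to89
open Literature.MathematicalPhysics.QuantumFieldTheory.Balaban1983to89.Node00
open Literature.MathematicalPhysics.QuantumFieldTheory.Balaban1983to89.B9PinMembersKLevelV1 (MemberY geo9Y bg9Y)
open Literature.MathematicalPhysics.QuantumFieldTheory.Balaban1983to89.B9BackgroundsKLevelV1R (RegFamY bg9YR MemOfFam mem_of_reg335R)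
open Literature.MathematicalPhysics.QuantumFieldTheory.Balaban1983to89.B7Prop2SpecialUnitary (specialUnitaryUnits)
open Literature.MathematicalPhysics.QuantumFieldTheory.Balaban1983to89.B6GlobalChartV1 (blkV1)
open Literature.MathematicalPhysics.QuantumFieldTheory.Balaban1983to89.B6Ineq2142KLevelV1 (β lvl)
open Literature.MathematicalPhysics.QuantumFieldTheory.Balaban1983to89.B6Geom246MultiLevelTorus (geomT)
open Literature.MathematicalPhysics.QuantumFieldTheory.Balaban1983to89.B9CoReadingCoordsTranspose (TrIdx trBasis)
open Literature.MathematicalPhysics.QuantumFieldTheory.Balaban1983to89.B9CoReadingCoords (XBK blkBK)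
open Literature.MathematicalPhysics.QuantumFieldTheory.Balaban1983to89.B9CoReadingCoordsH (XHK blkHK)
open Literature.MathematicalPhysics.QuantumFieldTheory.Balaban1983to89.B9GeoNormsKLevelV1 (geo9K geo9K_dist_nonneg)
open Literature.MathematicalPhysics.QuantumFieldTheory.Balaban1983to89.B9GeoLemma21KLevelV1 (geo9Y_dist_triangle geo9Y_dist_comm geo9Y_len_pos rowSum261_geo9Y geo9K_one_le_L)
open Literature.MathematicalPhysics.QuantumFieldTheory.Balaban1983to89.B9Thm34Ext (toB6)
open Literature.MathematicalPhysics.QuantumFieldTheory.Balaban1983to89.B9SectDL2Decay (BlockBd)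
open Literature.MathematicalPhysics.QuantumFieldTheory.Balaban1983to89.B11SectG (RowSum)
open Literature.MathematicalPhysics.QuantumFieldTheory.Balaban1983to89.B9Thm312Whole (Ops GeoOK)
open Literature.MathematicalPhysics.QuantumFieldTheory.Balaban1983to89.B9Thm312WholeDir (Thm33G0L2M)
open Literature.MathematicalPhysics.QuantumFieldTheory.Balaban1983to89.B9RWSums347DefiniteFaces (geo9Y_scalars)
open Literature.MathematicalPhysics.QuantumFieldTheory.Balaban1983to89.Node00.OpsYSectDCoords (QscoKH QcoKH)
open Literature.MathematicalPhysics.QuantumFieldTheory.Balaban1983to89.B9Thm313WholeQstarFromG0 (gQs_l2_of_l0 dGQs_l2_of_l1 ddGQs_l2_of_l3)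

variable {N : ℕ}

/-- ★★★ **THE BLOCK-L² `G₀Q\*` FAMILY AND THE `Q` LINE FROM THE G₀ LAYER AND TWO DISPLAYED BLOCK-L² LAWS, MEMBER-UNIFORMLY** (module docstring): from the G₀ layer's
block-L² lines (`hL2`, `Thm33G0L2M` at `B12₂ ∕ δ12₀`) and the laws `hqsL2K ∕ hqL2K` (`Q⋆`, `Q` in block-L² at `BQ ∕ δQ`, `δQ ≥ δ12₃ + 1`), ONE `obtain` gives `ML ≥ M12`,
`BL ≥ 0` and the five block-L² fields `gQs ∕ dGQs ∕ ddGQs q ∕ dGQsd ν ∕ q` at rate `δ12₃` (`BL := B12₂·BQ·c + BQ`, `c` the [4] (2.61) row constant at rate 1).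
[cite: Balaban1985BackgroundPropagators, Thm 3.13 p.426, (3.153) p.426, (3.46) p.398, (3.110) p.417, (3.13) p.393; Balaban1984PropagatorsII, (2.26) p.228, Lemma 2.1 (2.60)–(2.61) p.234; Balaban1984PropagatorsI, (1.18) p.20] -/
theorem g0qstar_l2_letters_of_laws (θ : Stage3Params) (Mstar : ℕ) {R₁ R₂ : RegFamY θ.d₆ θ.ℓ₆ θ.hd' θ.hL' θ.b₀ θ.b₁ Mstar (Matrix (Fin N) (Fin N) ℂ)} {c : ℝ}
    [∀ x : MemberY θ.d₆ θ.ℓ₆ θ.hd' θ.hL' θ.b₀ θ.b₁ Mstar, Fintype (geo9Y x).Site]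
    (H12 : MemberY θ.d₆ θ.ℓ₆ θ.hd' θ.hL' θ.b₀ θ.b₁ Mstar → Prop) {W12 : MemberY θ.d₆ θ.ℓ₆ θ.hd' θ.hL' θ.b₀ θ.b₁ Mstar → Type} [∀ x, Fintype (W12 x)]
    (𝔬12 : ∀ x : MemberY θ.d₆ θ.ℓ₆ θ.hd' θ.hL' θ.b₀ θ.b₁ Mstar, B9Thm312Whole.Ops (geo9Y x) (bg9YR (Matrix (Fin N) (Fin N) ℂ) (specialUnitaryUnits (Fin N)) R₁ R₂ x) (XBK (TrIdx N) x.toKIdx) (XBK (TrIdx N) x.toKIdx) (XHK (TrIdx N) x.toKIdx) (W12 x))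
    (Dd Dds : ∀ x : MemberY θ.d₆ θ.ℓ₆ θ.hd' θ.hL' θ.b₀ θ.b₁ Mstar, (bg9YR (Matrix (Fin N) (Fin N) ℂ) (specialUnitaryUnits (Fin N)) R₁ R₂ x).Cfg → Fin (θ.d₆ + 1) → Module.End ℝ (XBK (TrIdx N) x.toKIdx → ℝ))
    {M12 a12 B12₂ δ12₀ δ12₃ : ℝ} (hB12₂ : 0 ≤ B12₂) (hδ30 : 0 ≤ δ12₃) (hδ₃₀ : δ12₃ ≤ δ12₀)
    -- [CASCADE-K K2] THE AVERAGING PAIR's BLOCK-L² MAJORANTS AT THE MEMBER, DISPLAYED (today: dag-n06-w5's `blockBd_QscoKH_len` ∕ `blockBd_Q_pinsB_len` at the straight pair above the (2.60) threshold; knit: the block-L² sizes of print's `Q ∕ Q†`) — rate `δQ ≥ δ12₃ + 1`, constant `BQ ≥ 0`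
    (BQ δQ : ℝ) (hBQ : 0 ≤ BQ) (hδQ : δ12₃ + 1 ≤ δQ)
    (hqsL2K : ∀ x : MemberY θ.d₆ θ.ℓ₆ θ.hd' θ.hL' θ.b₀ θ.b₁ Mstar, M12 ≤ (geo9Y x).M → ∀ α₀ : ℝ, 0 < α₀ → (geo9Y x).M * α₀ ≤ a12 →
      ∀ U : (bg9YR (Matrix (Fin N) (Fin N) ℂ) (specialUnitaryUnits (Fin N)) R₁ R₂ x).Cfg, (bg9YR (Matrix (Fin N) (Fin N) ℂ) (specialUnitaryUnits (Fin N)) R₁ R₂ x).Reg335 c α₀ U →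
        BlockBd (g := toB6 (geo9Y x) 1 (H12 x)) (𝔬12 x).blkZ (𝔬12 x).blk ((𝔬12 x).Qstar U)
          (fun (y y' : (geo9Y x).Site) => BQ * ((geo9Y x).len y)⁻¹ *
            (Real.sqrt (((((θ.ℓ₆ + 1 : ℕ) : ℝ) ^ (θ.d₆ + 1)) ^ lvl x.hN x.D x.hk y')⁻¹) * (geo9Y x).len y') * Real.exp (-(δQ * (geo9Y x).dist y y'))))
    (hqL2K : ∀ x : MemberY θ.d₆ θ.ℓ₆ θ.hd' θ.hL' θ.b₀ θ.b₁ Mstar, M12 ≤ (geo9Y x).M → ∀ α₀ : ℝ, 0 < α₀ → (geo9Y x).M * α₀ ≤ a12 →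
      ∀ U : (bg9YR (Matrix (Fin N) (Fin N) ℂ) (specialUnitaryUnits (Fin N)) R₁ R₂ x).Cfg, (bg9YR (Matrix (Fin N) (Fin N) ℂ) (specialUnitaryUnits (Fin N)) R₁ R₂ x).Reg335 c α₀ U →
        BlockBd (g := toB6 (geo9Y x) 1 (H12 x)) (𝔬12 x).blk (𝔬12 x).blkZ ((𝔬12 x).Q U)
          (fun (y y' : (geo9Y x).Site) => BQ * (Real.sqrt (((((θ.ℓ₆ + 1 : ℕ) : ℝ) ^ (θ.d₆ + 1)) ^ lvl x.hN x.D x.hk y)⁻¹) * (geo9Y x).len y *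
            ((geo9Y x).len y')⁻¹) * Real.exp (-(δQ * (geo9Y x).dist y y'))))
    (hL2 : ∀ x : MemberY θ.d₆ θ.ℓ₆ θ.hd' θ.hL' θ.b₀ θ.b₁ Mstar, M12 ≤ (geo9Y x).M → ∀ α₀ : ℝ, 0 < α₀ → (geo9Y x).M * α₀ ≤ a12 → ∀ U : (bg9YR (Matrix (Fin N) (Fin N) ℂ) (specialUnitaryUnits (Fin N)) R₁ R₂ x).Cfg, (bg9YR (Matrix (Fin N) (Fin N) ℂ) (specialUnitaryUnits (Fin N)) R₁ R₂ x).Reg335 c α₀ U →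
      (bg9YR (Matrix (Fin N) (Fin N) ℂ) (specialUnitaryUnits (Fin N)) R₁ R₂ x).Reg336 c α₀ U → Thm33G0L2M (𝔬12 x) (Dd x) (Dds x) 1 (H12 x) B12₂ δ12₀ U) :
    ∃ (ML BL : ℝ), M12 ≤ ML ∧ 0 ≤ BL ∧
      ∀ x : MemberY θ.d₆ θ.ℓ₆ θ.hd' θ.hL' θ.b₀ θ.b₁ Mstar, ML ≤ (geo9Y x).M → ∀ α₀ : ℝ, 0 < α₀ → (geo9Y x).M * α₀ ≤ a12 → ∀ U : (bg9YR (Matrix (Fin N) (Fin N) ℂ) (specialUnitaryUnits (Fin N)) R₁ R₂ x).Cfg, (bg9YR (Matrix (Fin N) (Fin N) ℂ) (specialUnitaryUnits (Fin N)) R₁ R₂ x).Reg335 c α₀ U → (bg9YR (Matrix (Fin N) (Fin N) ℂ) (specialUnitaryUnits (Fin N)) R₁ R₂ x).Reg336 c α₀ U →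
        BlockBd (g := toB6 (geo9Y x) 1 (H12 x)) (𝔬12 x).blkZ (𝔬12 x).blk ((𝔬12 x).G0 U ∘ₗ (𝔬12 x).Qstar U)
          (fun (y y' : (geo9Y x).Site) => BL * (geo9Y x).len y * (Real.sqrt (((((θ.ℓ₆ + 1 : ℕ) : ℝ) ^ (θ.d₆ + 1)) ^ lvl x.hN x.D x.hk y')⁻¹) * (geo9Y x).len y') * Real.exp (-(δ12₃ * (geo9Y x).dist y y'))) ∧
        BlockBd (g := toB6 (geo9Y x) 1 (H12 x)) (𝔬12 x).blkZ (𝔬12 x).blkY ((𝔬12 x).D U ∘ₗ (𝔬12 x).G0 U ∘ₗ (𝔬12 x).Qstar U)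
          (fun (y y' : (geo9Y x).Site) => BL * (Real.sqrt (((((θ.ℓ₆ + 1 : ℕ) : ℝ) ^ (θ.d₆ + 1)) ^ lvl x.hN x.D x.hk y')⁻¹) * (geo9Y x).len y') * Real.exp (-(δ12₃ * (geo9Y x).dist y y'))) ∧
        (∀ q : Fin (θ.d₆ + 1) × Fin (θ.d₆ + 1),
          BlockBd (g := toB6 (geo9Y x) 1 (H12 x)) (𝔬12 x).blkZ (𝔬12 x).blk ((Dd x U q.1 ∘ₗ Dd x U q.2) ∘ₗ (𝔬12 x).G0 U ∘ₗ (𝔬12 x).Qstar U)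
            (fun (y y' : (geo9Y x).Site) => BL * (((geo9Y x).len y)⁻¹ * (Real.sqrt (((((θ.ℓ₆ + 1 : ℕ) : ℝ) ^ (θ.d₆ + 1)) ^ lvl x.hN x.D x.hk y')⁻¹) * (geo9Y x).len y')) * Real.exp (-(δ12₃ * (geo9Y x).dist y y')))) ∧
        (∀ ν : Fin (θ.d₆ + 1),
          BlockBd (g := toB6 (geo9Y x) 1 (H12 x)) (𝔬12 x).blkZ (𝔬12 x).blk (Dd x U ν ∘ₗ (𝔬12 x).G0 U ∘ₗ (𝔬12 x).Qstar U)
            (fun (y y' : (geo9Y x).Site) => BL * (Real.sqrt (((((θ.ℓ₆ + 1 : ℕ) : ℝ) ^ (θ.d₆ + 1)) ^ lvl x.hN x.D x.hk y')⁻¹) * (geo9Y x).len y') * Real.exp (-(δ12₃ * (geo9Y x).dist y y')))) ∧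
        BlockBd (g := toB6 (geo9Y x) 1 (H12 x)) (𝔬12 x).blk (𝔬12 x).blkZ ((𝔬12 x).Q U)
          (fun (y y' : (geo9Y x).Site) => BL * (Real.sqrt (((((θ.ℓ₆ + 1 : ℕ) : ℝ) ^ (θ.d₆ + 1)) ^ lvl x.hN x.D x.hk y)⁻¹) * (geo9Y x).len y * ((geo9Y x).len y')⁻¹) * Real.exp (-(δ12₃ * (geo9Y x).dist y y'))) := by
  -- a [4] (2.61) row sum at rate 1 (only its constant enters)
  obtain ⟨MR, cL, hrowL⟩ := rowSum261_geo9Y (d := θ.d₆) (ℓ := θ.ℓ₆) (hd := θ.hd') (hL := θ.hL') (b₀ := θ.b₀) (b₁ := θ.b₁) (Mstar := Mstar) 1 one_pos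
  have hrow : ∀ x : MemberY θ.d₆ θ.ℓ₆ θ.hd' θ.hL' θ.b₀ θ.b₁ Mstar, MR ≤ (geo9Y x).M → RowSum (toB6 (geo9Y x) 1 (H12 x)) 1 (max cL 0) := fun x hM y => (hrowL x hM y).trans (le_max_left _ _)
  have hc0 : (0 : ℝ) ≤ max cL 0 := le_max_right _ _
  have hBE : 0 ≤ B12₂ * BQ * max cL 0 := mul_nonneg (mul_nonneg hB12₂ hBQ) hc0
  refine ⟨max M12 MR, B12₂ * BQ * max cL 0 + BQ, le_max_left _ _, add_nonneg hBE hBQ, fun x hM α₀ hα ha U hU hU' => ?_⟩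
  letI : Fintype (geo9K x.toKIdx).Site := (inferInstance : Fintype (geo9Y x).Site)
  have hM12x : M12 ≤ (geo9Y x).M := (le_max_left _ _).trans hM
  have hMRx : MR ≤ (geo9Y x).M := (le_max_right _ _).trans hM
  have hG : GeoOK (geo9Y x) := ⟨geo9Y_dist_triangle x, geo9Y_dist_comm x, geo9K_dist_nonneg x.toKIdx, geo9Y_len_pos x⟩
  have hL2x := hL2 x hM12x α₀ hα ha U hU hU'
  have hqs := hqsL2K x hM12x α₀ hα ha U hU
  have hq := hqL2K x hM12x α₀ hα ha U hU
  have hB4 : B12₂ * BQ * max cL 0 ≤ B12₂ * BQ * max cL 0 + BQ := le_add_of_nonneg_right hBQ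
  have hvZ : ∀ y : (geo9Y x).Site, 0 ≤ Real.sqrt (((((θ.ℓ₆ + 1 : ℕ) : ℝ) ^ (θ.d₆ + 1)) ^ lvl x.hN x.D x.hk y)⁻¹) := fun y => Real.sqrt_nonneg _
  refine ⟨gQs_l2_of_l0 hG (hrow x hMRx) hvZ hB12₂ hBQ hδ30 hδ₃₀ hδQ hB4 hL2x.l0 hqs,
    dGQs_l2_of_l1 hG (hrow x hMRx) hvZ hB12₂ hBQ hδ30 hδ₃₀ hδQ hB4 hL2x.l1 hqs,
    fun q => ddGQs_l2_of_l3 hG (hrow x hMRx) hvZ hB12₂ hBQ hδ30 hδ₃₀ hδQ hB4 (hL2x.l3 q) hqs,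
    fun ν => dGQs_l2_of_l1 hG (hrow x hMRx) hvZ hB12₂ hBQ hδ30 hδ₃₀ hδQ hB4 (hL2x.l1d ν) hqs, ?_⟩
  -- the `Q` line: the law, its rate weakened to `δ12₃` and its constant raised to `BL`
  refine hq.mono fun y y' => ?_
  have hd0 : 0 ≤ (geo9Y x).dist y y' := geo9K_dist_nonneg x.toKIdx y y'
  have hρQ : δ12₃ ≤ δQ := by linarith
  have h1 : Real.exp (-(δQ * (geo9Y x).dist y y')) ≤ Real.exp (-(δ12₃ * (geo9Y x).dist y y')) :=
    Real.exp_le_exp.mpr (neg_le_neg (mul_le_mul_of_nonneg_right hρQ hd0))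
  have hw : 0 ≤ Real.sqrt (((((θ.ℓ₆ + 1 : ℕ) : ℝ) ^ (θ.d₆ + 1)) ^ lvl x.hN x.D x.hk y)⁻¹) * (geo9Y x).len y * ((geo9Y x).len y')⁻¹ :=
    mul_nonneg (mul_nonneg (Real.sqrt_nonneg _) (geo9Y_len_pos x y).le) (inv_nonneg.mpr (geo9Y_len_pos x y').le)
  have hBL : BQ ≤ B12₂ * BQ * max cL 0 + BQ := le_add_of_nonneg_left hBE
  calc BQ * (Real.sqrt (((((θ.ℓ₆ + 1 : ℕ) : ℝ) ^ (θ.d₆ + 1)) ^ lvl x.hN x.D x.hk y)⁻¹) * (geo9Y x).len y * ((geo9Y x).len y')⁻¹) *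
        Real.exp (-(δQ * (geo9Y x).dist y y'))
      ≤ BQ * (Real.sqrt (((((θ.ℓ₆ + 1 : ℕ) : ℝ) ^ (θ.d₆ + 1)) ^ lvl x.hN x.D x.hk y)⁻¹) * (geo9Y x).len y * ((geo9Y x).len y')⁻¹) *
        Real.exp (-(δ12₃ * (geo9Y x).dist y y')) := mul_le_mul_of_nonneg_left h1 (mul_nonneg hBQ hw)
    _ ≤ (B12₂ * BQ * max cL 0 + BQ) * (Real.sqrt (((((θ.ℓ₆ + 1 : ℕ) : ℝ) ^ (θ.d₆ + 1)) ^ lvl x.hN x.D x.hk y)⁻¹) * (geo9Y x).len y * ((geo9Y x).len y')⁻¹) *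
        Real.exp (-(δ12₃ * (geo9Y x).dist y y')) :=
        mul_le_mul_of_nonneg_right (mul_le_mul_of_nonneg_right hBL hw) (Real.exp_nonneg _)

end Summit.QuantumFields.YangMills.BalabanUVNodes.N06G0QstarL2LettersLegAtPinsPUPar

end
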